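import Summits.QuantumFields.YangMills.Theorems.BalabanUVNodesN10AtRecord11B13

/-!
# BalabanUVNodes ∕ N10 AT NODE 00's [B13] GROUP OF RECORD — THE FLAG-FREE HALVES: [Balaban1988RG2Cluster] Lemmas 1–2 ALONE from their located inputs,
# (2.38) ∕ Lemma 3 ALONE at LEVEL T from (2.26) per term, at the two-scale torus step of record `Node00.WtOfRecord θ lam` ∕ constants `Node00.c13OfRecord θ lam`
# (Track A, DAG node N10 [B13]; strategy s2 «by-name knit at the record»; seat `pub-ymgap-dag-n10-d`, gen g3; companion of `…N10AtRecord11B13` p459088, whose §1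
# types the same junction BUNDLED — Lemmas 1–2 + the Lemma-3 FLAG, resp. all three at LEVEL T)

HONEST FRAMING.  Count-neutral kernel bookkeeping over LANDED modules: NODE 00's `CarriersB13` (p457685: `ResidB13 θ`, `WtOfRecord θ lam`, `c13OfRecord θ lam` with their
`rfl` faces, `termDomination_WtOfRecord`, `B13LeafOfRecord`), dag-p2's `B13NodeTorusTermwise.lemma12_twoTorus` (p411918), the Lemma-3 torus chain
`B13Lemma3TorusSocket.hRep_of_termwise` ∕ `bound238With_of_hRep`, `TreeLengthTorusGeometry236Printed.ineq236Printed_torus`, `B13.bound238With_half`,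
`B13Lemma3Torus.lemma3Printed_torus` — cited BY NAME, nothing re-derived.  WHY THIS FILE (director-ym's open ruling «N10 ZEROTOWER content clause», NODE-TABLE v29 l.4;
this seat's desk note `HOME/pub-ymgap-dag-n10-d/N10-FORALL-LAWFUL-NOTE.md`): in the ∃-currency of K1′'s `stub_nodes12` the N10 conjunct is junk-dischargeable through the
TERMS of the hidden layer (`…N10AtRecord12B13.exists_record₁₂C_world_b13_main_of_zeroTower`, p468258; def-B13's `exists_isRecordOfRecord₁₂CB10YZWB8B12B13_forall_b13_univ`,
p466945); the ∀-LAWFUL reading «for EVERY layer `lam : ResidB13 θ` satisfying print's located inputs, the printed lemma holds at the group of record» is NOT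
junk-dischargeable, and this file names its two halves as stand-alone theorems (the companion's §1 only has them bundled with the Lemma-3 FLAG ∕ with each other):
§1 `lemma12OfRecord_of_located` — Lemma 1 ∧ Lemma 2 AS PRINTED at the group of record from their located inputs ONLY; `bound238OfRecord_of_termwise226` — (2.38) at
the group of record, `Restr`-FREE, from (2.26) per term + `Lemma3Numerics` + `8 ≤ L` (termwise domination DISCHARGED: H(Z) IS the sum of its terms at the group of
record) — the face a (D4) ∕ N26 consumer (seat dag-n26-c's N10 → (D4) → N26 junction at the seven-pin ₁₂ record, which today reads (2.38) through `(lam13 P).Restr`)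
takes WITHOUT the layer's restriction sentence; `lemma3OfRecord_of_termwise226` — Lemma 3 AS PRINTED (`Restr → (2.38)`) from the same; `b13LeafOfRecord_of_halves` —
the leaf triple re-assembled, feeding §2–§3 of the companion and `…N10AtRecord12B13` unchanged.
PRINT CHECK (pages read 2026-08-26, `paper:balaban1988-cmp116-rg-ii-cluster`): Lemma 1's printed SENTENCE (p. 9) names «the second expression in the fluctuation
field action in (I.2.13) … represented as the sum Σ_{Y∈𝐃_k} V′_k(Y, U_{k+1}, B) (1.33)»; its PROOF is generic (p. 2: «there exists a function E(X,U,J,A) analytic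
and localized to X in U, J, A, such that a given term is obtained substituting a proper nonlocal expression in the place of A … let us consider one important and
typical term»).  The theorems below are that GENERIC content at the group of record; the identification of the layer's terms with (I.2.13)'s ∕ (2.9)'s (a term
tower OF RECORD — def-T ∕ node00-def-B13's row, NOT in the tree) is NOT claimed, and NODE A's content ((2.26) per term for Bałaban's (2.14) kernels, [13] Thm
3.10∕3.12; one rung lower: dag-n10-c's walks junctions p460837 ∕ p463177 ∕ p467660) stays DISPLAYED as `Termwise226`.  N10 is NOT discharged; nothing of Bałaban's
is asserted; no node count moves; one finite four-torus programme at fixed ε per run; nothing continuum ∕ ℝ⁴ ∕ OS ∕ mass-gap ∕ Clay.  0 `sorry`, 0 `def`, standard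
axioms.  Stage-3 keyed (NOT in the ₁₁-vacuity class).  Filed `--supports` K1′ «StabilityBAtRecordR12e» (stmt-QuantumFields-19903) `--as helper`.

WHAT THIS FILE PROVES.  §1 `lemma12OfRecord_of_located`, `bound238OfRecord_of_termwise226`, `lemma3OfRecord_of_termwise226`, `b13LeafOfRecord_of_halves`.
-/

noncomputable section

namespace Summit.QuantumFields.YangMills.BalabanUVNodes.N10AtRecord11B13Halves

open Literature.MathematicalPhysics.QuantumFieldTheory.Balaban1983to89
open Literature.MathematicalPhysics.QuantumFieldTheory.Balaban1983to89.Node00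
open Literature.MathematicalPhysics.QuantumFieldTheory.Balaban1983to89.B13Lemma3Torus (TwoTorusStep)
open Literature.MathematicalPhysics.QuantumFieldTheory.Balaban1983to89.B13Lemma3TorusSocket (TermDomination Termwise226 Lemma3Numerics)
open Metric
open Literature.MathematicalPhysics.QuantumFieldTheory.Balaban1983to89.B16Absorption (pbox)
open Literature.MathematicalPhysics.QuantumFieldTheory.Balaban1983to89.TreeLengthTorus
open Literature.MathematicalPhysics.QuantumFieldTheory.Balaban1983to89.TreeLengthTorusTransfer (tcoarse tclosureDom)
open Literature.MathematicalPhysics.QuantumFieldTheory.Balaban1983to89.B12TreeDecay (kappa₀ K₀)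
open Literature.MathematicalPhysics.QuantumFieldTheory.Balaban1983to89.B13PkScaling (Qop scaled)
open Literature.MathematicalPhysics.QuantumFieldTheory.Balaban1983to89.B13NodeTorusTermwise (lemma12_twoTorus)

/-! ## §1. THE FLAG-FREE HALVES AT THE GROUP OF RECORD — Lemmas 1–2 alone; (2.38) ∕ Lemma 3 alone at LEVEL T; the triple from the halves (Stage 3) -/

section Halves

variable (θ : Stage3Params) (lam : ResidB13 θ)

set_option maxSynthPendingDepth 3 in
/-- **LEMMAS 1–2 AS PRINTED AT NODE 00's GROUP OF RECORD FROM THEIR LOCATED INPUTS ONLY — NO LEMMA-3 FLAG** (the ∀-lawful half of N10: for EVERY layer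
`lam : ResidB13 θ` whose (1.33) term families satisfy print's located inputs, `B13.Lemma1Printed ∧ B13.Lemma2Printed` hold for the step of record `WtOfRecord θ lam`
at the constants of record `c13OfRecord θ lam`).  This is `B13NodeTorusTermwise.lemma12_twoTorus` AT THOSE OBJECTS with every identification binder discharged by
`CarriersB13`'s faces (`h133 := WtOfRecord_Vp`, `hVpp := WtOfRecord_Vpp`, `hrd := WtOfRecord_rd`, `hV := WtOfRecord_V`, `hQ := WtOfRecord_Q`, `hvolk := rfl`,
`hAdd ∕ hZero := ResidB13.analytic_add ∕ analytic_zero`, `hL2 := Stage3Params.hL'`); the hypothesis list is `b13LeafOfRecord_of_located`'s WITHOUT `h3`.  What stays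
displayed is print's located input of Lemma 1 (pp. 7–9: [I]'s block geometry of the index families, per-term analyticity on (1.34), thresholds R7–R9 on the letters,
per-term (1.24)∕(1.30) `h124 h130` BY REFERENCE to [I] (3.54), (3.17), [15] Prop. 4, [13] (3.108), the constants with headroom `(1 − ϑ)`) and of Lemma 2 (pp. 10–11:
curvature terms, plaquette data (1.38)–(1.42), floor, gauge invariance by assertion).  PRINT CHECK: Lemma 1's printed SENTENCE (p. 9) names «the second expression in
the fluctuation field action in (I.2.13)»; its PROOF (p. 2: «there exists a function E(X,U,J,A) analytic and localized to X in U, J, A, such that a given term is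
obtained substituting a proper nonlocal expression in the place of A») is generic in the term family — this theorem is that generic content at the group of record;
the identification of `lam`'s terms with (I.2.13)'s is NOT claimed (term tower of record, absent).  Count-neutral. [cite: Balaban1988RG2Cluster, Lemma 1 (1.33)–(1.36) p.9, Lemma 2 (1.43) p.11, p.2] -/
theorem lemma12OfRecord_of_located
    (hN12 : 12 ≤ (θ.ℓ₆ + 1) * (lam.n + 1))
    -- (1) LEMMA 1: [I]'s block geometry of the (1.33) index families of the layer
    (dist : TDom 4 ((θ.ℓ₆ + 1) * (lam.n + 1)) → TPt 4 ((θ.ℓ₆ + 1) * (lam.n + 1)) → (j : ℕ) →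
      TPt 4 ((θ.ℓ₆ + 1) ^ (lam.k - j) * ((θ.ℓ₆ + 1) * (lam.n + 1))) → ℝ) {K K' : ℝ}
    (hS0Y : ∀ Y, ∀ a ∈ lam.S0 Y,
      (pbox (fun i => natLift a i - (5 : ℕ)) (fun i => natLift a i + 1 + (5 : ℕ))).image (proj ((θ.ℓ₆ + 1) * (lam.n + 1))) ⊆ Y.1)
    (hFsub : ∀ Y a, lam.F Y a ⊆
      (pbox (fun i => natLift a i - (5 : ℕ)) (fun i => natLift a i + 1 + (5 : ℕ))).image (proj ((θ.ℓ₆ + 1) * (lam.n + 1))) \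
        (pbox (fun i => natLift a i - (4 : ℕ)) (fun i => natLift a i + 1 + (4 : ℕ))).image (proj ((θ.ℓ₆ + 1) * (lam.n + 1))))
    (hSq : ∀ Y, ∀ a ∈ lam.S0 Y, ∀ j, lam.Sq Y a j ⊆
      (Finset.univ : Finset (TPt 4 ((θ.ℓ₆ + 1) ^ (lam.k - j) * ((θ.ℓ₆ + 1) * (lam.n + 1))))).filter
        (fun q => tcoarse ((θ.ℓ₆ + 1) ^ (lam.k - j)) ((θ.ℓ₆ + 1) * (lam.n + 1)) q ∈
          (pbox (fun i => natLift a i - (2 : ℕ)) (fun i => natLift a i + 1 + (2 : ℕ))).image (proj ((θ.ℓ₆ + 1) * (lam.n + 1)))))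
    (hScY : ∀ Y, lam.Sc Y ⊆ Y.1)
    (hdist0 : ∀ Y a j q, 0 ≤ lam.c.δ₀ * dist Y a j q)
    (hdist : ∀ Y a j (n : ℕ) q, q ∉ (pbox (fun i => (((θ.ℓ₆ + 1) ^ (lam.k - j) : ℕ) : ℤ) * natLift a i - (n + 1 : ℕ))
      (fun i => (((θ.ℓ₆ + 1) ^ (lam.k - j) : ℕ) : ℤ) * natLift a i + 2 * (((θ.ℓ₆ + 1) ^ (lam.k - j) : ℕ) : ℤ) - 1 + (n + 1 : ℕ))).image
        (proj ((θ.ℓ₆ + 1) ^ (lam.k - j) * ((θ.ℓ₆ + 1) * (lam.n + 1)))) → lam.c.δ₀ * lam.c.M * ((n : ℝ) + 1) ≤ lam.c.δ₀ * dist Y a j q)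
    (hSX : ∀ Y a j q, lam.SX Y a j q ⊆ (tcubeSys 4 ((θ.ℓ₆ + 1) ^ (lam.k - j) * ((θ.ℓ₆ + 1) * (lam.n + 1)))).above q)
    (hSX' : ∀ Y a j q, lam.SX' Y a j q ⊆ (tcubeSys 4 ((θ.ℓ₆ + 1) ^ (lam.k - j) * ((θ.ℓ₆ + 1) * (lam.n + 1)))).above q)
    (hX0 : ∀ Y, ∀ a ∈ lam.Sc Y, ∀ j ∈ Finset.range (lam.k + 1), ∀ q ∈ lam.Sq' Y a j, ∀ x ∈ lam.SX' Y a j q,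
      x.1.image (tcoarse ((θ.ℓ₆ + 1) ^ (lam.k - j)) ((θ.ℓ₆ + 1) * (lam.n + 1))) ⊆ Y.1)
    -- (1) LEMMA 1: per-term analyticity on (1.34)
    (hAnT : ∀ Y, ∀ a ∈ lam.S0 Y, ∀ X ∈ (lam.F Y a).powerset, ∀ j ∈ Finset.range (lam.k + 1), ∀ q ∈ lam.Sq Y a j,
      ∀ x ∈ lam.SX Y a j q, AnalyticOnNhd ℂ (lam.T Y a X j q x) (lam.sp1 Y))
    (hAnT' : ∀ Y, ∀ a ∈ lam.Sc Y, ∀ j ∈ Finset.range (lam.k + 1), ∀ q ∈ lam.Sq' Y a j, ∀ x ∈ lam.SX' Y a j q,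
      AnalyticOnNhd ℂ (lam.T' Y a j q x) (lam.sp1 Y))
    -- (1) LEMMA 1: thresholds and restrictions on the residual constants
    (hK : 0 ≤ K) (hK' : 0 ≤ K') (hκ : 0 ≤ lam.c.κ) (hδ1 : lam.c.δ < 1) (hδκ : 1 ≤ lam.c.δ * lam.c.κ)
    (hκ126 : kappa₀ 64 8 ≤ lam.c.κ) (hκ126' : kappa₀ 64 8 ≤ lam.c.δ * lam.c.κ)
    (hκ₁ : 1 + 2 * Real.log (8 * 12 ^ 3) ≤ lam.c.κ₁) (hκ₁' : 2 + 16 * Real.log 128 ≤ lam.c.κ₁)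
    (hδ₀M : 10 * Real.exp (-1) ≤ lam.c.δ₀ * lam.c.M) (hδ₀M5 : 2 * Real.log 5 ≤ lam.c.δ₀ * lam.c.M)
    (hR8 : (1 - lam.c.δ) * lam.c.κ ≤ (1 / 4) * (lam.c.κ₁ - 1)) (hR9 : (1 - 2 * lam.c.δ) * lam.c.κ ≤ (1 / 16) * lam.c.κ₁)
    -- (1) LEMMA 1: per-term (1.24), (1.30) by reference to [I] (3.54), (3.17), [15] Prop. 4, [13] (3.108); the constants with headroom (1 − ϑ)
    (h124 : ∀ Y φ, φ ∈ lam.sp1 Y → ∀ a ∈ lam.S0 Y, ∀ X ∈ (lam.F Y a).powerset, ∀ j ∈ Finset.range (lam.k + 1), ∀ q ∈ lam.Sq Y a j,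
      ∀ x ∈ lam.SX Y a j q,
        ‖lam.T Y a X j q x φ‖ ≤ K * (((θ.ℓ₆ + 1 : ℕ) : ℝ) ^ j * (((θ.ℓ₆ + 1 : ℕ) : ℝ) ^ lam.k)⁻¹) ^ 5 *
          Real.exp (-(lam.c.κ₁ - 1) *
            (((Y.1 \ (pbox (fun i => natLift a i - (5 : ℕ)) (fun i => natLift a i + 1 + (5 : ℕ))).image
              (proj ((θ.ℓ₆ + 1) * (lam.n + 1)))).card : ℝ) + X.card)) *
          Real.exp (-(lam.c.κ * torusTreeLen x.1)))
    (h130 : ∀ Y φ, φ ∈ lam.sp1 Y → ∀ a ∈ lam.Sc Y, ∀ j ∈ Finset.range (lam.k + 1), ∀ q ∈ lam.Sq' Y a j,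
      ∀ x ∈ lam.SX' Y a j q,
        ‖lam.T' Y a j q x φ‖ ≤ K' * Real.exp (-(1 / 2) * (lam.c.δ₀ * lam.c.M) * (((θ.ℓ₆ + 1 : ℕ) : ℝ) ^ j * (((θ.ℓ₆ + 1 : ℕ) : ℝ) ^ lam.k)⁻¹)⁻¹
            - (1 / 2) * lam.c.δ₀ * dist Y a j q) *
          Real.exp (-(lam.c.κ₁ - 1) * ((Y.1 \ x.1.image (tcoarse ((θ.ℓ₆ + 1) ^ (lam.k - j)) ((θ.ℓ₆ + 1) * (lam.n + 1)))).card : ℝ)) *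
          Real.exp (-(lam.c.κ * torusTreeLen x.1)))
    {ϑ : ℝ} (hϑ0 : 0 ≤ ϑ) (hϑ1 : ϑ < 1)
    (hC : K * K₀ 64 8 * (2 * (6 * ((θ.ℓ₆ + 1 : ℕ) : ℝ)) ^ 4) * Real.exp 1 * Real.exp ((1 / 8) * lam.c.κ₁ * (12 ^ 4 - 1)) +
        2 * (64 * K') * K₀ 64 8 * 1344 ≤
      (1 - ϑ) * (lam.c.E₀ * lam.c.ε₁ * lam.c.C₁ * lam.c.M ^ lam.c.q * Real.exp (lam.c.C₂ * lam.c.κ₁)))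
    -- (2) LEMMA 2 (pp. 10–11): the curvature terms; the located per-term data of `B13Lemma2Torus.lemma2Printed_twoTorus'` for the layer's plaquette data
    (hGlAn : ∀ Y, AnalyticOnNhd ℂ (lam.Gl Y) (lam.sp1 Y))
    (hGl : ∀ Y φ, φ ∈ lam.sp1 Y → ‖lam.Gl Y φ‖ ≤ ϑ * (lam.c.E₀ * lam.c.ε₁ * lam.c.C₁ * lam.c.M ^ lam.c.q * Real.exp (lam.c.C₂ * lam.c.κ₁)) *
      Real.exp (-((1 - 2 * lam.c.δ) * lam.c.κ * (tsys 4 ((θ.ℓ₆ + 1) * (lam.n + 1))).dj Y)))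
    (he : ∀ Y b, ‖lam.e Y b‖ ≤ 1) (hg : lam.g ≠ 0)
    {R K₂ : ℝ} {m₂ : ℕ} (hK₂ : 0 ≤ K₂) (hR : 0 < R) (hε3 : 3 * lam.c.ε₁ ≤ R)
    (hW : ∀ Y, ∀ i ∈ lam.s Y, ∀ φ ∈ lam.sp1 Y, AnalyticOnNhd ℂ (lam.Wf Y i φ) (ball 0 R))
    (hKW : ∀ Y, ∀ i ∈ lam.s Y, ∀ φ ∈ lam.sp1 Y, ∀ z ∈ ball (0 : lam.E) R,
      ‖lam.Wf Y i φ z‖ ≤ K₂ * Real.exp (-(lam.c.κ₁ - 1) * ((Y.1.card : ℝ) - 1)) * ‖z‖ ^ 3)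
    (hcard : ∀ Y, (lam.s Y).card ≤ m₂ * Y.1.card)
    (hsp : ∀ Y φ, φ ∈ lam.sp1 Y → ‖lam.g‖ * ‖lam.rd Y φ‖ < lam.c.ε₁)
    (hfloor : 27 * m₂ * K₂ * Real.exp (lam.c.κ₁ - 1) ≤ lam.c.C₃ * lam.c.M ^ 4 * Real.exp (lam.c.C₂ * lam.c.κ₁))
    (hAnP : ∀ Y, ∀ i ∈ lam.s Y, AnalyticOnNhd ℂ (fun φ => scaled lam.g (lam.Wf Y i φ) (lam.rd Y φ)) (lam.sp1 Y))
    (hG : ∀ Y, lam.GaugeInv (lam.V Y) ∧ lam.GaugeInv ((WtOfRecord θ lam).toStepData.quadForm Y) ∧ lam.GaugeInv (lam.Vpp Y)) :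
    B13.Lemma1Printed (WtOfRecord θ lam).toStepData (c13OfRecord θ lam) ∧ B13.Lemma2Printed (WtOfRecord θ lam).toStepData (c13OfRecord θ lam) :=
  lemma12_twoTorus (WtOfRecord θ lam) (c13OfRecord θ lam) lam.k hN12 θ.hL'.2 lam.S0 lam.F lam.Sq lam.SX lam.T
    lam.Sc lam.Sq' lam.SX' lam.T' dist (WtOfRecord_Vp lam) hS0Y hFsub hSq hScY hdist0 hdist hSX hSX' hX0
    (fun _ _ _ hf hg => lam.analytic_add hf hg) lam.analytic_zero hAnT hAnT' hK hK' hκ hδ1 hδκ hκ126 hκ126' hκ₁ hκ₁' hδ₀M hδ₀M5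
    hR8 hR9 h124 h130 hϑ0 hϑ1 hC lam.Gl (WtOfRecord_Vpp lam) hGlAn hGl lam.rd lam.e he (WtOfRecord_rd lam) lam.s lam.Wf hg hK₂ hR
    hε3 hW hKW hcard (WtOfRecord_V lam) (fun Y φ b b' _ => WtOfRecord_Q lam Y φ b b') hsp (fun _ => rfl) hfloor hAnP hG

/-- **(2.38) AT NODE 00's GROUP OF RECORD, `Restr`-FREE, AT LEVEL T — FROM (2.26) PER TERM, THE NUMBERS AT ℓ = ½L AND `8 ≤ L` ONLY** (the ∀-lawful Lemma-3 half of
N10: for EVERY layer `lam : ResidB13 θ` whose terms `lam.T₃` of H(Z) carry the (2.26)-majorants, `B13.Bound238` holds for `WtOfRecord θ lam` at `c13OfRecord θ lam`).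
H(Z) IS the sum of its terms at the group of record, so termwise domination is the THEOREM `termDomination_WtOfRecord` (discharged); the (2.36) geometry at the printed
ℓ = ½L is `TreeLengthTorusGeometry236Printed.ineq236Printed_torus` (`8 ≤ L = θ.ℓ₆ + 1`); LEVEL T → LEVEL R → (2.38) is `B13Lemma3TorusSocket.hRep_of_termwise` →
`bound238With_of_hRep` → `B13.bound238With_half` — exactly the Lemma-3 leg of `B13NodeTorusTermwise.b13Leaf_twoTorus_termwise`, here WITHOUT the Lemma 1–2 inputs.
This is the face a (D4) ∕ N26 consumer reads at the record WITHOUT passing through the layer's restriction sentence `lam.Restr` (lever (ii) of the honesty census):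
displayed = `Termwise226 (c13OfRecord θ lam) a a₅ (WtOfRecord θ lam) lam.T₃` ((2.26) PER TERM — NODE A's content for Bałaban's (2.14) kernels, [13] Thm 3.10∕3.12;
one rung lower: dag-n10-c's walks junctions) + `Lemma3Numerics` (print's restrictions on the letters) + `8 ≤ θ.ℓ₆ + 1`.  Count-neutral.
[cite: Balaban1988RG2Cluster, Lemma 3 (2.38) p.20, (2.26) p.17, (2.36) p.19] -/
theorem bound238OfRecord_of_termwise226 (hL8 : 8 ≤ θ.ℓ₆ + 1) {a a₂ a₂' a₅ Aabs : ℝ}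
    (h226 : Termwise226 (c13OfRecord θ lam) a a₅ (WtOfRecord θ lam) lam.T₃)
    (hN : Lemma3Numerics (c13OfRecord θ lam) (lam.m₃ + 1) (((θ.ℓ₆ + 1 : ℕ) : ℝ) / 2) a a₂ a₂' a₅ Aabs) :
    B13.Bound238 (WtOfRecord θ lam).toStepData (c13OfRecord θ lam) :=
  have h236 : B13.Ineq236With (tsys 4 ((θ.ℓ₆ + 1) * (lam.n + 1))) (tsys 4 (lam.n + 1))
      (tclosureDom (θ.ℓ₆ + 1) (lam.n + 1)) ((((c13OfRecord θ lam).L : ℕ) : ℝ) / 2) :=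
    TreeLengthTorusGeometry236Printed.ineq236Printed_torus (d := 4) (θ.ℓ₆ + 1) (lam.n + 1) hL8
  (B13.bound238With_half (WtOfRecord θ lam).toStepData (c13OfRecord θ lam)).1
    (B13Lemma3TorusSocket.bound238With_of_hRep (c13OfRecord θ lam) (c13OfRecord_L θ lam) (WtOfRecord θ lam) (lam.m₃ + 1) hN h236
      (B13Lemma3TorusSocket.hRep_of_termwise (c13OfRecord θ lam) (mul_nonneg hN.hα₆.le hN.hε₀) (WtOfRecord θ lam) lam.T₃
        (termDomination_WtOfRecord lam) h226))

/-- **LEMMA 3 AS PRINTED AT NODE 00's GROUP OF RECORD AT LEVEL T** (`B13.Lemma3Printed := Restr → (2.38)`): from (2.26) per term, the numbers at ℓ = ½L and `8 ≤ L`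
— `bound238OfRecord_of_termwise226` under the (unused) restriction sentence (`B13Lemma3Torus.lemma3Printed_torus`).  The ∀-lawful Lemma-3 half; no Lemma 1–2 input.
Count-neutral: (2.26) per term is NODE A's content, displayed. [cite: Balaban1988RG2Cluster, Lemma 3 p.20] -/
theorem lemma3OfRecord_of_termwise226 (hL8 : 8 ≤ θ.ℓ₆ + 1) {a a₂ a₂' a₅ Aabs : ℝ}
    (h226 : Termwise226 (c13OfRecord θ lam) a a₅ (WtOfRecord θ lam) lam.T₃)
    (hN : Lemma3Numerics (c13OfRecord θ lam) (lam.m₃ + 1) (((θ.ℓ₆ + 1 : ℕ) : ℝ) / 2) a a₂ a₂' a₅ Aabs) :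
    B13.Lemma3Printed (WtOfRecord θ lam).toStepData (c13OfRecord θ lam) :=
  B13Lemma3Torus.lemma3Printed_torus _ _ (bound238OfRecord_of_termwise226 θ lam hL8 h226 hN)

/-- **The [B13] leaf of record re-assembled from its two ∀-lawful halves** (bookkeeping: `B13LeafOfRecord θ lam` IS the triple Lemma 1 ∧ Lemma 2 ∧ Lemma 3 AS PRINTED at
`WtOfRecord θ lam ∕ c13OfRecord θ lam`): a consumer holding `lemma12OfRecord_of_located …` and `lemma3OfRecord_of_termwise226 …` (or the FLAG, or
`B13Lemma3Torus.lemma3Printed_torus _ _ h238`) has the leaf — and then N10 at the pin ∕ at the Stage-12 record by §2–§3 and `…N10AtRecord12B13`.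
[cite: Balaban1988RG2Cluster, Lemmas 1–3 pp.9, 11, 20 (bookkeeping)] -/
theorem b13LeafOfRecord_of_halves
    (h12 : B13.Lemma1Printed (WtOfRecord θ lam).toStepData (c13OfRecord θ lam) ∧ B13.Lemma2Printed (WtOfRecord θ lam).toStepData (c13OfRecord θ lam))
    (h3 : B13.Lemma3Printed (WtOfRecord θ lam).toStepData (c13OfRecord θ lam)) : B13LeafOfRecord θ lam :=
  ⟨h12.1, h12.2, h3⟩

end Halves

end Summit.QuantumFields.YangMills.BalabanUVNodes.N10AtRecord11B13Halves

end
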